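import Literature.Barriers.ResolutionOfSingularities.LocalMonomializationFailsLemma
import Mathlib.RingTheory.AlgebraicIndependent.TranscendenceBasis
import Mathlib.FieldTheory.IntermediateField.Adjoin.Algebra
import Mathlib.FieldTheory.SeparableDegree
import HarnessLib

/-!
# Cutkosky's counterexample: the fields `K* = F(x,y) ⊇ K = F(u,v)` and the rings `A ⊆ B`

`Literature/Barriers/ResolutionOfSingularities/LocalMonomializationFailsSetup.lean` — the
set-up of §3 of Cutkosky's paper over an arbitrary base field `F` of characteristic `p`
(for Theorem 1.4 with `n > 2` the base field is `F = k(t₁, …, t_{n−2})`, p. 7), PROVED: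

* `cu p x y = xᵖ(1+y)`, `cv p x y = yᵖ + x` (the images of `cU`, `cV` of
  `LocalMonomializationFails.lean`); for algebraically independent `x, y` generating `L` over `F`:
  `u, v` are algebraically independent (`algebraicIndependent_uv`), `L` is algebraic, indeed
  finite, over `K = F(u,v)` (`y` is a root of `Y^{p²+1} + Y^{p²} − vᵖY + (u − vᵖ)`, `x = v − yᵖ`),
  and separable over `K` (the derivative at `y` is `(yᵖ − v)ᵖ = (−x)ᵖ ≠ 0`) — "`K*` is separable
  over `K` since the Jacobian of `u` and `v` is not zero … so `K*` is a finite extension of `K`";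
* `A = F[u,v]_{(u,v)} = originLocalRing`, `B = F[x,y]_{(x,y)}`: `A ≤ B` and `B` dominates `A`
  ("We have that `B` dominates `A`"), and the expansions (4) of Lemma 3.1 hold for `(u, v)` in
  `B̂ = F[[x,y]]` with `c₀ = f₀ = e₀ = 1`, `τ₀ = 1`, `Λ₀ = Ω₀ = 0` (`lemmaShape_initial`);
* generic helpers: a pair generating the same field as an algebraically independent pair is
  algebraically independent (`algebraicIndependent_of_isAlgebraic_adjoin`), the bridge
  `Dominates ↔ SubringDominates` asked for by the review of `QuadraticTransforms.lean`.

[cite: Cutkosky2014, §3 (p. 5)]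
-/

noncomputable section

namespace Literature.Barriers.ResolutionOfSingularities

namespace Cutkosky

open Literature.AlgebraicGeometry.Resolution
open scoped IntermediateField

universe u

/-! ## Generic helpers -/

section Helpers

variable {F : Type u} [Field F] {L : Type u} [Field L] [Algebra F L]

/-- The bridge between the barrier file's `Dominates` (subalgebras) and `SubringDominates`
(subrings, `QuadraticTransforms.lean`): they are the same clause. [folklore] -/
theorem dominates_iff_subringDominates (A B : Subalgebra F L) :
    Dominates F L A B ↔ SubringDominates A.toSubring B.toSubring :=
  Iff.rfl

/-- `ValuationDominates` is `SubringDominates _ O.toSubring`. [folklore] -/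
theorem valuationDominates_iff_subringDominates (V : ValuationSubring L) (B : Subalgebra F L) :
    ValuationDominates F L V B ↔ SubringDominates B.toSubring V.toSubring :=
  Iff.rfl

omit [Field L] [Algebra F L] in
/-- The range of a pair. [folklore] -/
theorem range_pair (a b : L) : Set.range ![a, b] = {a, b} := by
  ext z
  simp only [Set.mem_range, Set.mem_insert_iff, Set.mem_singleton_iff]
  constructor
  · rintro ⟨i, rfl⟩
    fin_cases i <;> simp
  · rintro (rfl | rfl)
    exacts [⟨0, rfl⟩, ⟨1, rfl⟩]

/-- If `L` is algebraic over `F(y₁, …, yₙ)` and contains `n` algebraically independent elements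
then `y` is algebraically independent (transcendence degree count). [folklore] -/
theorem algebraicIndependent_of_isAlgebraic_adjoin {n : ℕ} {x y : Fin n → L}
    (hx : AlgebraicIndependent F x)
    [halg : Algebra.IsAlgebraic (IntermediateField.adjoin F (Set.range y)) L] :
    AlgebraicIndependent F y := by
  open scoped IntermediateField.algebraAdjoinAdjoin in
  haveI : Algebra.IsAlgebraic (Algebra.adjoin F (Set.range y)) L :=
    Algebra.IsAlgebraic.trans (Algebra.adjoin F (Set.range y))
      (IntermediateField.adjoin F (Set.range y)) L
  exact (Algebra.IsAlgebraic.isTranscendenceBasis_of_lift_le_trdeg_of_finite F y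
    hx.lift_cardinalMk_le_trdeg).1

/-- `L` is algebraic over an intermediate field equal to `⊤`. [folklore] -/
theorem isAlgebraic_of_adjoin_eq_top {S : Set L} (h : IntermediateField.adjoin F S = ⊤) :
    Algebra.IsAlgebraic (IntermediateField.adjoin F S) L :=
  ⟨fun a => isAlgebraic_algebraMap (⟨a, h ▸ IntermediateField.mem_top⟩ : IntermediateField.adjoin F S)⟩

/-- A pair generating `L = F(x)` over `F`, with `x` an algebraically independent pair, is
algebraically independent. [folklore] -/
theorem algebraicIndependent_of_adjoin_eq_top {n : ℕ} {x y : Fin n → L}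
    (hx : AlgebraicIndependent F x) (hy : IntermediateField.adjoin F (Set.range y) = ⊤) :
    AlgebraicIndependent F y :=
  haveI := isAlgebraic_of_adjoin_eq_top hy
  algebraicIndependent_of_isAlgebraic_adjoin hx

/-- Elements of `F[x]_{(x)}` given by a polynomial lie in the maximal ideal iff the polynomial has
no constant term. [folklore] -/
theorem aeval_mem_maximalIdeal_originLocalRing_iff {n : ℕ} {x : Fin n → L}
    (hx : AlgebraicIndependent F x) (f : MvPolynomial (Fin n) F) :
    (haveI := isLocalRing_originLocalRing hx;
      (⟨MvPolynomial.aeval x f, aeval_mem_originLocalRing hx f⟩ : originLocalRing hx) ∈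
        IsLocalRing.maximalIdeal (originLocalRing hx)) ↔ MvPolynomial.constantCoeff f = 0 := by
  rw [← constantCoeff_originTaylorAt_eq_zero_iff, originTaylorAt_aeval, constantCoeff_coe]

end Helpers

/-! ## The elements `u = xᵖ(1+y)`, `v = yᵖ + x` -/

section Elements

variable {L : Type u} [Field L]

/-- `u = xᵖ(1 + y)`. [cite: Cutkosky2014, §3] -/
def cu (p : ℕ) (x y : L) : L := x ^ p * (1 + y)

/-- `v = yᵖ + x`. [cite: Cutkosky2014, §3] -/
def cv (p : ℕ) (x y : L) : L := y ^ p + x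

variable (F : Type u) [Field F] [Algebra F L]

/-- `u` is the value of the polynomial `cU`. [cite: Cutkosky2014, §3] -/
theorem aeval_cU (p : ℕ) (x y : L) : MvPolynomial.aeval ![x, y] (cU F p) = cu p x y := by
  simp [cU, cu]

/-- `v` is the value of the polynomial `cV`. [cite: Cutkosky2014, §3] -/
theorem aeval_cV (p : ℕ) (x y : L) : MvPolynomial.aeval ![x, y] (cV F p) = cv p x y := by
  simp [cV, cv]

/-- **The printed relation**: `y^{p²+1} + y^{p²} − y vᵖ + (u − vᵖ) = 0` in `L`
(from `cutkosky_relation`). [cite: Cutkosky2014, §3] -/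
theorem relation (p : ℕ) [Fact p.Prime] [CharP F p] (x y : L) :
    y ^ (p ^ 2 + 1) + y ^ (p ^ 2) - y * cv p x y ^ p + (cu p x y - cv p x y ^ p) = 0 := by
  have h := congrArg (MvPolynomial.aeval (R := F) ![x, y]) (cutkosky_relation F p)
  simpa [aeval_cU, aeval_cV] using h

end Elements

/-! ## The extension `L = F(x,y) ⊇ K = F(u,v)` -/

section Extension

variable (F : Type u) [Field F] {L : Type u} [Field L] [Algebra F L] (p : ℕ) {x y : L}

/-- `K = F(u, v) ⊆ L`. [cite: Cutkosky2014, §3] -/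
def Kuv (x y : L) : IntermediateField F L :=
  IntermediateField.adjoin F {cu p x y, cv p x y}

/-- `u ∈ K`. [cite: Cutkosky2014, §3] -/
theorem cu_mem_Kuv : cu p x y ∈ Kuv F p x y :=
  IntermediateField.subset_adjoin _ _ (Set.mem_insert _ _)

/-- `v ∈ K`. [cite: Cutkosky2014, §3] -/
theorem cv_mem_Kuv : cv p x y ∈ Kuv F p x y :=
  IntermediateField.subset_adjoin _ _ (Set.mem_insert_of_mem _ rfl)

/-- `v` as an element of `K`. [cite: Cutkosky2014, §3] -/
def kv (x y : L) : Kuv F p x y := ⟨cv p x y, cv_mem_Kuv F p⟩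

/-- `u` as an element of `K`. [cite: Cutkosky2014, §3] -/
def ku (x y : L) : Kuv F p x y := ⟨cu p x y, cu_mem_Kuv F p⟩

/-- The monic relation of `y` over `K`: `Y^{p²+1} + Y^{p²} − vᵖ·Y + (u − vᵖ) ∈ K[Y]`.
[cite: Cutkosky2014, §3] -/
def relPoly (x y : L) : Polynomial (Kuv F p x y) :=
  Polynomial.X ^ (p ^ 2 + 1) + Polynomial.X ^ (p ^ 2) -
    Polynomial.C (kv F p x y ^ p) * Polynomial.X + Polynomial.C (ku F p x y - kv F p x y ^ p)

/-- The relation polynomial is monic. [cite: Cutkosky2014, §3] -/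
theorem relPoly_monic [hp : Fact p.Prime] (x y : L) : (relPoly F p x y).Monic := by
  have h2 : 2 ≤ p := hp.out.two_le
  have hlt : 1 < p ^ 2 + 1 := by nlinarith
  have hdeg : (Polynomial.X ^ (p ^ 2 + 1) + Polynomial.X ^ (p ^ 2) : Polynomial (Kuv F p x y)).degree =
      (p ^ 2 + 1 : ℕ) := by
    rw [Polynomial.degree_add_eq_left_of_degree_lt, Polynomial.degree_X_pow]
    rw [Polynomial.degree_X_pow, Polynomial.degree_X_pow]
    exact_mod_cast Nat.lt_succ_self _
  have hmon : (Polynomial.X ^ (p ^ 2 + 1) + Polynomial.X ^ (p ^ 2) : Polynomial (Kuv F p x y)).Monic := by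
    refine Polynomial.Monic.add_of_left (Polynomial.monic_X_pow _) ?_
    rw [Polynomial.degree_X_pow, Polynomial.degree_X_pow]
    exact_mod_cast Nat.lt_succ_self _
  have hdeg2 : (Polynomial.X ^ (p ^ 2 + 1) + Polynomial.X ^ (p ^ 2) -
      Polynomial.C (kv F p x y ^ p) * Polynomial.X : Polynomial (Kuv F p x y)).degree = (p ^ 2 + 1 : ℕ) := by
    rw [Polynomial.degree_sub_eq_left_of_degree_lt, hdeg]
    rw [hdeg]
    exact (Polynomial.degree_C_mul_X_le _).trans_lt (by exact_mod_cast hlt)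
  unfold relPoly
  refine Polynomial.Monic.add_of_left (Polynomial.Monic.sub_of_left hmon ?_) ?_
  · rw [hdeg]
    exact (Polynomial.degree_C_mul_X_le _).trans_lt (by exact_mod_cast hlt)
  · rw [hdeg2]
    exact Polynomial.degree_C_le.trans_lt (by exact_mod_cast Nat.succ_pos _)

/-- `y` is a root of the relation polynomial. [cite: Cutkosky2014, §3] -/
theorem aeval_relPoly [Fact p.Prime] [CharP F p] (x y : L) :
    Polynomial.aeval y (relPoly F p x y) = 0 := by
  have h := relation F p x y
  simp only [relPoly, kv, ku, map_add, map_sub, map_mul, map_pow, Polynomial.aeval_X, Polynomial.aeval_C,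
    IntermediateField.algebraMap_apply]
  linear_combination h

/-- `y` is integral over `K = F(u,v)`. [cite: Cutkosky2014, §3] -/
theorem isIntegral_y [Fact p.Prime] [CharP F p] (x y : L) : IsIntegral (Kuv F p x y) y :=
  ⟨relPoly F p x y, relPoly_monic F p x y, by
    rw [← Polynomial.aeval_def]; exact aeval_relPoly F p x y⟩

/-- `x = v − yᵖ` is integral over `K`. [cite: Cutkosky2014, §3] -/
theorem isIntegral_x [Fact p.Prime] [CharP F p] (x y : L) : IsIntegral (Kuv F p x y) x := by
  have hv : IsIntegral (Kuv F p x y) (cv p x y) := isIntegral_algebraMap (x := kv F p x y)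
  have h := hv.sub ((isIntegral_y F p x y).pow p)
  rwa [show cv p x y - y ^ p = x by simp [cv]] at h

/-- The characteristic of an algebra over a field of characteristic `p` is `p`. [folklore] -/
theorem charP_of_algebra_field [CharP F p] (E : Type*) [Field E] [Algebra F E] : CharP E p :=
  charP_of_injective_algebraMap (algebraMap F E).injective p

/-- The derivative of the relation polynomial is `Y^{p²} − vᵖ` (characteristic `p`).
[cite: Cutkosky2014, §3] -/
theorem derivative_relPoly [Fact p.Prime] [CharP F p] (x y : L) :
    Polynomial.derivative (relPoly F p x y) = Polynomial.X ^ (p ^ 2) - Polynomial.C (kv F p x y ^ p) := by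
  haveI : CharP (Kuv F p x y) p := charP_of_algebra_field F p (Kuv F p x y)
  have h0 : ((p : ℕ) : Kuv F p x y) = 0 := CharP.cast_eq_zero _ p
  have h1 : ((p ^ 2 + 1 : ℕ) : Kuv F p x y) = 1 := by push_cast; rw [h0]; ring
  have h2 : ((p ^ 2 : ℕ) : Kuv F p x y) = 0 := by
    push_cast; rw [h0]; exact zero_pow two_ne_zero
  simp only [relPoly, Polynomial.derivative_add, Polynomial.derivative_sub, Polynomial.derivative_X_pow,
    Polynomial.derivative_mul, Polynomial.derivative_C, Polynomial.derivative_X, h1, h2, map_one, one_mul,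
    map_zero, zero_mul, zero_add, mul_one, add_zero, Nat.add_sub_cancel]

/-- The derivative of the relation polynomial at `y` is `(yᵖ − v)ᵖ = (−x)ᵖ`.
[cite: Cutkosky2014, §3] -/
theorem aeval_derivative_relPoly [Fact p.Prime] [CharP F p] (x y : L) :
    Polynomial.aeval y (Polynomial.derivative (relPoly F p x y)) = (-x) ^ p := by
  haveI : CharP L p := charP_of_algebra_field F p L
  rw [derivative_relPoly]
  simp only [map_sub, map_pow, Polynomial.aeval_X, Polynomial.aeval_C, kv, IntermediateField.algebraMap_apply]
  have hxv : -x = y ^ p - cv p x y := by simp [cv]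
  rw [hxv, sub_pow_char, ← pow_mul, sq]

/-- **`y` is separable over `K`** (its minimal polynomial divides the relation, at which the
derivative does not vanish at `y`). [cite: Cutkosky2014, §3] -/
theorem isSeparable_y [Fact p.Prime] [CharP F p] (hxy : AlgebraicIndependent F ![x, y]) :
    IsSeparable (Kuv F p x y) y := by
  have hx0 : x ≠ 0 := by simpa using hxy.ne_zero 0
  have hP' : Polynomial.aeval y (Polynomial.derivative (relPoly F p x y)) ≠ 0 := by
    rw [aeval_derivative_relPoly]
    exact pow_ne_zero _ (neg_ne_zero.mpr hx0)
  obtain ⟨Q, hQ⟩ := minpoly.dvd (Kuv F p x y) y (aeval_relPoly F p x y)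
  have hmin' : Polynomial.aeval y (Polynomial.derivative (minpoly (Kuv F p x y) y)) ≠ 0 := by
    intro h0
    apply hP'
    rw [hQ, Polynomial.derivative_mul, map_add, map_mul, map_mul, h0, minpoly.aeval, zero_mul,
      zero_mul, add_zero]
  change (minpoly (Kuv F p x y) y).Separable
  rw [Polynomial.separable_iff_derivative_ne_zero (minpoly.irreducible (isIntegral_y F p x y))]
  intro hd
  exact hmin' (by rw [hd, map_zero])

variable (hgen : IntermediateField.adjoin F {x, y} = ⊤)
include hgen

/-- `K(x, y) = L`. [cite: Cutkosky2014, §3] -/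
theorem adjoin_Kuv_eq_top : IntermediateField.adjoin (Kuv F p x y) {x, y} = ⊤ := by
  apply IntermediateField.restrictScalars_injective F
  rw [IntermediateField.restrictScalars_top, eq_top_iff, ← hgen, IntermediateField.adjoin_le_iff]
  exact IntermediateField.subset_adjoin _ _

/-- **`K* = L` is finite over `K = F(u,v)`** ("so `K*` is a finite extension of `K`").
[cite: Cutkosky2014, §3] -/
theorem finiteDimensional_Kuv [Fact p.Prime] [CharP F p] : FiniteDimensional (Kuv F p x y) L := by
  have h : FiniteDimensional (Kuv F p x y) (IntermediateField.adjoin (Kuv F p x y) {x, y}) :=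
    IntermediateField.finiteDimensional_adjoin (by
      intro z hz
      rcases hz with h | h
      · rw [h]; exact isIntegral_x F p x y
      · rw [Set.mem_singleton_iff.mp h]; exact isIntegral_y F p x y)
  rw [adjoin_Kuv_eq_top F p hgen] at h
  exact LinearEquiv.finiteDimensional
    (IntermediateField.topEquiv (F := Kuv F p x y) (E := L)).toLinearEquiv

/-- `K* = L` is algebraic over `K = F(u,v)`. [cite: Cutkosky2014, §3] -/
theorem isAlgebraic_Kuv [Fact p.Prime] [CharP F p] : Algebra.IsAlgebraic (Kuv F p x y) L :=
  haveI := finiteDimensional_Kuv F p hgen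
  Algebra.IsAlgebraic.of_finite (Kuv F p x y) L

omit hgen in
/-- `x ∈ K(y)` (`x = v − yᵖ`). [cite: Cutkosky2014, §3] -/
theorem x_mem_adjoin_y : x ∈ IntermediateField.adjoin (Kuv F p x y) {y} := by
  have key : cv p x y - y ^ p ∈ IntermediateField.adjoin (Kuv F p x y) {y} :=
    sub_mem (IntermediateField.algebraMap_mem (IntermediateField.adjoin (Kuv F p x y) {y}) (kv F p x y))
      (pow_mem (IntermediateField.mem_adjoin_simple_self _ y) p)
  rwa [show cv p x y - y ^ p = x by simp [cv]] at key

/-- `K(y) = L`: "We have that `K* = K(y)`". [cite: Cutkosky2014, §3] -/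
theorem adjoin_Kuv_y_eq_top : IntermediateField.adjoin (Kuv F p x y) {y} = ⊤ := by
  rw [eq_top_iff, ← adjoin_Kuv_eq_top F p hgen, IntermediateField.adjoin_le_iff]
  intro z hz
  rcases hz with h | h
  · rw [h]; exact x_mem_adjoin_y F p
  · rw [Set.mem_singleton_iff.mp h]; exact IntermediateField.mem_adjoin_simple_self _ _

/-- **`K* = L` is separable over `K = F(u,v)`** ("`K*` is separable over `K` since the Jacobian
of `u` and `v` is not zero"). [cite: Cutkosky2014, §3] -/
theorem isSeparable_Kuv [Fact p.Prime] [CharP F p] (hxy : AlgebraicIndependent F ![x, y]) :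
    Algebra.IsSeparable (Kuv F p x y) L := by
  have h : Algebra.IsSeparable (Kuv F p x y) (IntermediateField.adjoin (Kuv F p x y) {y}) :=
    (IntermediateField.isSeparable_adjoin_simple_iff_isSeparable (F := Kuv F p x y) (E := L)).mpr
      (isSeparable_y F p hxy)
  rw [adjoin_Kuv_y_eq_top F p hgen] at h
  exact AlgEquiv.Algebra.isSeparable (IntermediateField.topEquiv (F := Kuv F p x y) (E := L))

/-- **`u, v` are algebraically independent over `F`** (`K = F(u,v)` is a two-dimensional rational
function field): `L` has transcendence degree `2` and is algebraic over `F(u,v)`.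
[cite: Cutkosky2014, §3] -/
theorem algebraicIndependent_uv [Fact p.Prime] [CharP F p] (hxy : AlgebraicIndependent F ![x, y]) :
    AlgebraicIndependent F ![cu p x y, cv p x y] := by
  haveI : Algebra.IsAlgebraic (IntermediateField.adjoin F (Set.range ![cu p x y, cv p x y])) L := by
    rw [range_pair]
    exact isAlgebraic_Kuv F p hgen
  exact algebraicIndependent_of_isAlgebraic_adjoin hxy

end Extension

/-! ## The rings `A = F[u,v]_{(u,v)} ⊆ B = F[x,y]_{(x,y)}` -/

section Rings

variable {F : Type u} [Field F] {L : Type u} [Field L] [Algebra F L] (p : ℕ)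
variable {x y : L} (hxy : AlgebraicIndependent F ![x, y])
  (huv : AlgebraicIndependent F ![cu p x y, cv p x y])

/-- `u, v ∈ B = F[x,y]_{(x,y)}`. [cite: Cutkosky2014, §3] -/
theorem uv_mem_B : ∀ i, ![cu p x y, cv p x y] i ∈ originLocalRing hxy := by
  refine Fin.forall_fin_two.mpr ⟨?_, ?_⟩
  · simpa [aeval_cU] using aeval_mem_originLocalRing hxy (cU F p)
  · simpa [aeval_cV] using aeval_mem_originLocalRing hxy (cV F p)

/-- `u, v` lie in the maximal ideal `(x, y)` of `B`. [cite: Cutkosky2014, §3] -/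
theorem uv_mem_maximalIdeal_B [hp : Fact p.Prime] : ∀ i, haveI := isLocalRing_originLocalRing hxy;
    (⟨![cu p x y, cv p x y] i, uv_mem_B p hxy i⟩ : originLocalRing hxy) ∈
      IsLocalRing.maximalIdeal (originLocalRing hxy) := by
  haveI := isLocalRing_originLocalRing hxy
  have hp0 : p ≠ 0 := hp.out.ne_zero
  refine Fin.forall_fin_two.mpr ⟨?_, ?_⟩
  · have e : (⟨![cu p x y, cv p x y] 0, uv_mem_B p hxy 0⟩ : originLocalRing hxy) =
        ⟨MvPolynomial.aeval ![x, y] (cU F p), aeval_mem_originLocalRing hxy _⟩ :=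
      Subtype.ext (by simp [aeval_cU])
    rw [e, aeval_mem_maximalIdeal_originLocalRing_iff]
    simp [cU, hp0]
  · have e : (⟨![cu p x y, cv p x y] 1, uv_mem_B p hxy 1⟩ : originLocalRing hxy) =
        ⟨MvPolynomial.aeval ![x, y] (cV F p), aeval_mem_originLocalRing hxy _⟩ :=
      Subtype.ext (by simp [aeval_cV])
    rw [e, aeval_mem_maximalIdeal_originLocalRing_iff]
    simp [cV, hp0]

/-- **`A ⊆ B`.** [cite: Cutkosky2014, §3] -/
theorem A_le_B [Fact p.Prime] : originLocalRing huv ≤ originLocalRing hxy :=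
  originLocalRing_le_of_forall_mem_maximalIdeal huv hxy (uv_mem_B p hxy) (uv_mem_maximalIdeal_B p hxy)

/-- **"`B` dominates `A`"** (`m_B ∩ A = m_A`). [cite: Cutkosky2014, §3] -/
theorem dominates_A_B [Fact p.Prime] : Dominates F L (originLocalRing huv) (originLocalRing hxy) :=
  ⟨A_le_B p hxy huv, fun _ hq hinv =>
    inv_mem_originLocalRing_of_forall_mem_maximalIdeal huv hxy (uv_mem_B p hxy)
      (uv_mem_maximalIdeal_B p hxy) hq hinv⟩

/-- **The expansions (4) for the initial pair**: in `B̂ = F[[x,y]]`, `u = xᵖ(1 + y)` and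
`v = yᵖ + x` have the shape of Lemma 3.1 with `c₀ = f₀ = e₀ = 1`, `τ₀ = 1`, `Λ₀ = Ω₀ = 0`.
[cite: Cutkosky2014, §3 and Lemma 3.1 (4)] -/
theorem lemmaShape_initial (hu : cu p x y ∈ originLocalRing hxy) (hv : cv p x y ∈ originLocalRing hxy) :
    LemmaShape p hxy ⟨cu p x y, hu⟩ ⟨cv p x y, hv⟩ 1 1 1 1 := by
  refine ⟨one_ne_zero, one_ne_zero, one_ne_zero, ?_, by simp, ⟨0, ?_⟩, ⟨0, by simp, ?_⟩⟩
  · intro m hm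
    rw [MvPowerSeries.coeff_one, if_neg]
    rintro rfl
    exact hm rfl
  · have e : (⟨cu p x y, hu⟩ : originLocalRing hxy) =
        ⟨MvPolynomial.aeval ![x, y] (cU F p), aeval_mem_originLocalRing hxy _⟩ :=
      Subtype.ext (by simp [aeval_cU])
    rw [e, originTaylorAt_aeval]
    simp only [cU, MvPolynomial.coe_mul, MvPolynomial.coe_pow, MvPolynomial.coe_X, MvPolynomial.coe_add,
      MvPolynomial.coe_one, map_one]
    ring
  · have e : (⟨cv p x y, hv⟩ : originLocalRing hxy) =
        ⟨MvPolynomial.aeval ![x, y] (cV F p), aeval_mem_originLocalRing hxy _⟩ :=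
      Subtype.ext (by simp [aeval_cV])
    rw [e, originTaylorAt_aeval]
    simp only [cV, MvPolynomial.coe_pow, MvPolynomial.coe_X, MvPolynomial.coe_add, map_one]
    ring

end Rings

end Cutkosky

end Literature.Barriers.ResolutionOfSingularities

end
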